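import Literature.Topology.FourManifolds.HomotopySpheresStablyParallelizableStability
import Literature.Topology.FourManifolds.CircleFramingClassification
import Literature.AlgebraicTopology.Homotopy.SphereMapsHomotopyGroups
import Mathlib.Geometry.Manifold.SmoothApprox
import Mathlib.Topology.CompactOpen
import HarnessLib

/-!
# Free loops in `GL⁺(m, ℝ)`: the `ℤ/2`-valued class of a loop, its stability, and the smooth
# loops of `CircleFramingClassification`

Topic `Literature/Topology/FourManifolds`. First module of the proof of the twisted-framing
exclusion in the middle-level fact
`Literature.Topology.FourManifolds.exists_middleLevel_isStabilization_of_isHCobordism`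
(`HCobordismMiddleLevel.lean`; R. Kirby, *The topology of 4-manifolds*, LNM 1374 (1989), Ch. X,
p. 55: *"The framing is zero in `π₁(SO(3)) = ℤ/2` because `W` is spin"*), whose only remaining
hypothesis in the tree is the step `hstep` of
`exists_middleLevel_isStabilization_of_isHCobordism_of_step` (`HCobordismMiddleLevelChain.lean`).
The framing obstruction of that proof is carried by free loops of frames; this file supplies the
elementary homotopy theory of free loops in `GL⁺(m, ℝ)` that it needs, **without ever using that
`π₁ SO(m)` is non-trivial** (only that it has at most two elements and is stable):

* §1–§3 `GLLoop.PosMat m` (matrices of positive determinant), stabilisation `A ↦ 1 ⊕ A`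
  (the tree's `SOTransport.blockSucc`), pointwise products and homotopies of families, and the
  Gram–Schmidt deformation of a family into `SO(m)` (`exists_soMap_homotopic`,
  `so_nullhomotopic_of_nullhomotopic`; Hatcher, *Algebraic Topology*, §3.D, via the tree's
  `homotopic_gramSchmidtNormed`).
* §4 the quotient parametrisation `qI : [0, 1] → 𝕊¹` and descent of families along it
  (`exists_descend_qI`, Mathlib's `IsQuotientMap.continuous_lift_prod_right`).
* §5–§6 **stability on free loops in `SO`**: every free loop in `SO(D + 1)` is freely homotopic to a
  stabilised loop for `D ≥ 2` (`exists_homotopic_inclSO`) and a loop in `SO(D)`, `D ≥ 3`, is freely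
  null-homotopic as soon as its stabilisation is (`nullhomotopic_of_inclSO`) — Hatcher §4.2,
  Example 4.55, proved by the tree's transport rotations (`SOTransport.exists_transport`,
  `exists_comp_inclSO_eq`, Hatcher Prop. 4.48 for the bundle `SO(D + 1) → 𝕊ᴰ`) and the vanishing
  of `π₁(𝕊ᴰ)`, `π₂(𝕊ᴰ)` (`subsingleton_homotopyGroup_sphere`,
  `nonempty_homotopyRel_cylBd_of_subsingleton`), the null-homotopy being based by the group
  structure and re-glued along `qI`.
* §7 the same two statements for free loops in `GL⁺(m, ℝ)` (`exists_homotopic_stabMap`,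
  `nullhomotopic_stabMap_iff`).
* §8–§9 operators on `𝔼 3` versus `3 × 3` matrices in the product topology; the matrix loop
  `matLoop L` of a smooth loop `L : OpLoop` (`TubeLinearReframe.lean`) of positive determinant;
  the **twisted loop** `tau 0 = matLoop OpLoop.twist` and its stabilisations `tau m`; a `Joined`
  family gives a free homotopy (`homotopic_matLoop_of_joined`); `τ · τ` is null-homotopic (the
  tree's quaternion computation `OpLoop.joined_twist_mul_twist_one`); and the **dichotomy**: every
  free loop in `GL⁺(m, ℝ)`, `m ≥ 3`, is null-homotopic or homotopic to `τ`
  (`nullhomotopic_or_homotopic_tau`; for `m = 3` by smooth approximation within `GL⁺` —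
  Mathlib's `Continuous.exists_contMDiff_approx` — and the tree's classification of smooth loops
  `OpLoop.exists_joined_one_or_twist`, Gompf–Stipsicz §5.2; for `m > 3` by stability).
* §10 the **class** `GLLoop.cls L ∈ ZMod 2` (`0` iff null-homotopic) with `cls_congr`,
  `cls_stabMap` (`m ≥ 3`), additivity `cls_mul` (`m ≥ 3`), `cls_const_mul`, `cls_mul_const`.
* §11 back to smooth loops: continuously homotopic smooth loops are `Joined`
  (`joined_of_homotopic_matLoop`: smooth approximation of the homotopy on `ℝ × 𝕊¹` inside a
  uniform room of invertible operators), `GL⁺(3, ℝ)` is path connected in the form needed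
  (`homotopic_const_one`, the tree's `nonempty_smoothMatrixPath_of_det_pos`), and the bridge
  `cls_matLoop_eq_zero_iff : cls (matLoop L) = 0 ↔ Joined L one`, which is what feeds the tree's
  `CircleNbhd.nonempty_diffeomorph_surgered_linTwist` downstream.

Everything is proved; no named facts are introduced (tags `[folklore]` and the cited sources).

## References

* A. Hatcher, *Algebraic Topology*, CUP (2002), §3.D (`O(n)` is a deformation retract of
  `GLₙ(ℝ)`), §4.1 p. 346, §4.2 Example 4.55 and Prop. 4.48 (stability of `πᵢ O(n)`, homotopy
  lifting for `O(n) → O(n+1) → Sⁿ`). [HatcherAT2002]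
* R. E. Gompf, A. I. Stipsicz, *4-Manifolds and Kirby Calculus*, GSM 20 (1999), §5.2
  (`π₁ SO(3) = ℤ/2`: the two framings of a circle in a 4-manifold). [GompfStipsiczGSM1999]
* M. W. Hirsch, *Differential Topology*, GTM 33 (1976), Ch. 4 §6, proof of Thm. 6.6
  (`GL⁺` is path connected). [HirschDT1976]
* R. C. Kirby, *The topology of 4-manifolds*, LNM 1374 (1989), Ch. X, p. 55. [Kirby1989]
-/

noncomputable section

open Set Function Metric Matrix InnerProductSpace Topology
open scoped Topology unitInterval Manifold ContDiff

namespace Literature.Topology.FourManifolds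

namespace GLLoop

open SOTransport Literature.AlgebraicTopology.Homotopy

/-- Local notation: `𝔼 n` is the model Euclidean space `EuclideanSpace ℝ (Fin n)`. -/
local notation "𝔼 " n:arg => EuclideanSpace ℝ (Fin n)

/-- Local notation: the unit circle in `𝔼 2`. -/
local notation "𝕊¹" => (sphere (0 : EuclideanSpace ℝ (Fin (1 + 1))) 1)

/-! ### 1. Matrices of positive determinant -/

/-- **`GL⁺(m, ℝ)`** as a subtype of the `m × m` real matrices: positive determinant. [folklore] -/
def PosMat (m : ℕ) : Type := {A : Matrix (Fin m) (Fin m) ℝ // 0 < A.det}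

namespace PosMat

variable {m : ℕ}

/-- The subspace topology. [folklore] -/
instance : TopologicalSpace (PosMat m) := instTopologicalSpaceSubtype

/-- The underlying matrix. [folklore] -/
theorem continuous_val : Continuous (Subtype.val : PosMat m → Matrix (Fin m) (Fin m) ℝ) :=
  continuous_subtype_val

/-- The identity matrix. [folklore] -/
instance : One (PosMat m) := ⟨⟨1, by rw [det_one]; exact one_pos⟩⟩

/-- Products of matrices of positive determinant. [folklore] -/
instance : Mul (PosMat m) := ⟨fun A B => ⟨A.1 * B.1, by rw [det_mul]; exact mul_pos A.2 B.2⟩⟩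

/-- The identity, as a matrix. [folklore] -/
@[simp] theorem one_val : (1 : PosMat m).1 = 1 := rfl

/-- Products, as matrices. [folklore] -/
@[simp] theorem mul_val (A B : PosMat m) : (A * B).1 = A.1 * B.1 := rfl

/-- Multiplication is continuous. [folklore] -/
theorem continuous_mul : Continuous fun p : PosMat m × PosMat m => p.1 * p.2 :=
  ((continuous_val.comp continuous_fst).mul (continuous_val.comp continuous_snd)).subtype_mk _

/-- Multiplication is continuous (instance form). [folklore] -/
instance : ContinuousMul (PosMat m) := ⟨continuous_mul⟩

/-- `GL⁺(m, ℝ)` is a monoid. [folklore] -/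
instance : Monoid (PosMat m) where
  mul_assoc A B C := Subtype.ext (Matrix.mul_assoc _ _ _)
  one_mul A := Subtype.ext (Matrix.one_mul _)
  mul_one A := Subtype.ext (Matrix.mul_one _)

/-- A special orthogonal matrix has positive determinant. [folklore] -/
def ofSO (A : specialOrthogonalGroup (Fin m) ℝ) : PosMat m :=
  ⟨A.1, by rw [(mem_specialOrthogonalGroup_iff.mp A.2).2]; exact one_pos⟩

/-- The matrix of `ofSO A`. [folklore] -/
@[simp] theorem ofSO_val (A : specialOrthogonalGroup (Fin m) ℝ) : (ofSO A).1 = A.1 := rfl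

/-- `ofSO` is continuous. [folklore] -/
theorem continuous_ofSO : Continuous (ofSO : specialOrthogonalGroup (Fin m) ℝ → PosMat m) :=
  continuous_subtype_val.subtype_mk _

/-- `ofSO 1 = 1`. [folklore] -/
@[simp] theorem ofSO_one : ofSO (1 : specialOrthogonalGroup (Fin m) ℝ) = 1 := rfl

/-- `ofSO` is multiplicative. [folklore] -/
theorem ofSO_mul (A B : specialOrthogonalGroup (Fin m) ℝ) : ofSO (A * B) = ofSO A * ofSO B := rfl

/-- **Stabilisation** `A ↦ 1 ⊕ A` (the tree's `SOTransport.blockSucc`). [folklore] -/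
def stab (A : PosMat m) : PosMat (m + 1) :=
  ⟨blockSucc A.1, by rw [det_blockSucc]; exact A.2⟩

/-- The matrix of `stab A`. [folklore] -/
@[simp] theorem stab_val (A : PosMat m) : (stab A).1 = blockSucc A.1 := rfl

/-- Stabilisation is continuous. [folklore] -/
theorem continuous_stab : Continuous (stab : PosMat m → PosMat (m + 1)) :=
  (continuous_blockSucc.comp continuous_val).subtype_mk _

/-- `stab 1 = 1`. [folklore] -/
@[simp] theorem stab_one : stab (1 : PosMat m) = 1 := Subtype.ext blockSucc_one

/-- Stabilisation is multiplicative. [folklore] -/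
theorem stab_mul (A B : PosMat m) : stab (A * B) = stab A * stab B :=
  Subtype.ext (blockSucc_mul A.1 B.1)

/-- Stabilisation commutes with `ofSO` (the tree's `inclSO`). [folklore] -/
theorem stab_ofSO (A : specialOrthogonalGroup (Fin m) ℝ) : stab (ofSO A) = ofSO (inclSO A) := rfl

end PosMat

open PosMat

/-! ### 2. Free loops and free homotopies in `GL⁺(m, ℝ)` -/

variable {m : ℕ} {X : Type*} [TopologicalSpace X]

/-- Stabilisation of a family. [folklore] -/
def stabMap (L : C(X, PosMat m)) : C(X, PosMat (m + 1)) := ⟨fun x => stab (L x), continuous_stab.comp L.2⟩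

/-- Values of `stabMap`. [folklore] -/
@[simp] theorem stabMap_apply (L : C(X, PosMat m)) (x : X) : stabMap L x = stab (L x) := rfl

/-- A family of special orthogonal matrices as a family in `GL⁺`. [folklore] -/
def soMap (Q : C(X, specialOrthogonalGroup (Fin m) ℝ)) : C(X, PosMat m) :=
  ⟨fun x => ofSO (Q x), continuous_ofSO.comp Q.2⟩

/-- Values of `soMap`. [folklore] -/
@[simp] theorem soMap_apply (Q : C(X, specialOrthogonalGroup (Fin m) ℝ)) (x : X) : soMap Q x = ofSO (Q x) := rfl

/-- `stabMap ∘ soMap = soMap ∘ inclSO`. [folklore] -/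
theorem stabMap_soMap (Q : C(X, specialOrthogonalGroup (Fin m) ℝ)) :
    stabMap (soMap Q) = soMap (inclSO.comp Q) := rfl

/-- Homotopies are compatible with stabilisation. [folklore] -/
theorem Homotopic.stabMap {L L' : C(X, PosMat m)} (h : L.Homotopic L') : (stabMap L).Homotopic (stabMap L') := by
  obtain ⟨H⟩ := h
  exact ⟨{ toFun := fun p => stab (H p),
           continuous_toFun := continuous_stab.comp H.continuous,
           map_zero_left := fun x => by simp,
           map_one_left := fun x => by simp }⟩

/-- Pointwise products of homotopic families are homotopic. [folklore] -/
theorem Homotopic.mul {L₁ L₁' L₂ L₂' : C(X, PosMat m)} (h₁ : L₁.Homotopic L₁') (h₂ : L₂.Homotopic L₂') :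
    (L₁ * L₂).Homotopic (L₁' * L₂') := by
  obtain ⟨H₁⟩ := h₁
  obtain ⟨H₂⟩ := h₂
  exact ⟨{ toFun := fun p => H₁ p * H₂ p,
           continuous_toFun := H₁.continuous.mul H₂.continuous,
           map_zero_left := fun x => by simp,
           map_one_left := fun x => by simp }⟩

/-- A null-homotopic family times anything: `Nullhomotopic` is absorbed on the left up to a
constant factor. [folklore] -/
theorem Homotopic.const_mul {L L' : C(X, PosMat m)} (A : PosMat m) (h : L.Homotopic L') :
    ((ContinuousMap.const X A) * L).Homotopic ((ContinuousMap.const X A) * L') :=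
  Homotopic.mul (ContinuousMap.Homotopic.refl _) h

/-! ### 3. Gram–Schmidt: every family in `GL⁺` is homotopic to a special orthogonal family -/

/-- The column family of a matrix, in `𝔼 m`. [folklore] -/
def cols (A : Matrix (Fin m) (Fin m) ℝ) (j : Fin m) : 𝔼 m := WithLp.toLp 2 fun i => A i j

/-- The matrix of a family of columns. [folklore] -/
def ofCols (f : Fin m → 𝔼 m) : Matrix (Fin m) (Fin m) ℝ := Matrix.of fun i j => f j i

/-- `ofCols ∘ cols = id`. [folklore] -/
@[simp] theorem ofCols_cols (A : Matrix (Fin m) (Fin m) ℝ) : ofCols (cols A) = A := by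
  ext i j; rfl

/-- `cols ∘ ofCols = id`. [folklore] -/
@[simp] theorem cols_ofCols (f : Fin m → 𝔼 m) : cols (ofCols f) = f := by
  ext j i; rfl

/-- `cols` is continuous. [folklore] -/
theorem continuous_cols : Continuous (cols : Matrix (Fin m) (Fin m) ℝ → Fin m → 𝔼 m) :=
  continuous_pi fun j => (PiLp.continuous_toLp 2 _).comp
    (continuous_pi fun i => (continuous_apply j).comp ((continuous_apply i).comp continuous_id))

/-- `ofCols` is continuous. [folklore] -/
theorem continuous_ofCols : Continuous (ofCols : (Fin m → 𝔼 m) → Matrix (Fin m) (Fin m) ℝ) := by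
  refine continuous_matrix fun i j => ?_
  exact (PiLp.continuous_apply 2 _ i).comp (continuous_apply j)

/-- The columns of a matrix of nonzero determinant are linearly independent. [folklore] -/
theorem linearIndependent_cols {A : Matrix (Fin m) (Fin m) ℝ} (hA : A.det ≠ 0) :
    LinearIndependent ℝ (cols A) := by
  have h1 : LinearIndependent ℝ A.col := by
    rw [Matrix.linearIndependent_cols_iff_isUnit, Matrix.isUnit_iff_isUnit_det]
    exact isUnit_iff_ne_zero.mpr hA
  have h2 : cols A = (WithLp.linearEquiv 2 ℝ (Fin m → ℝ)).symm ∘ A.col := by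
    ext j i; rfl
  rw [h2]
  exact h1.map' _ (LinearEquiv.ker _)

/-- An orthonormal column family gives an orthogonal matrix. [folklore] -/
theorem ofCols_mem_orthogonalGroup {f : Fin m → 𝔼 m} (hf : Orthonormal ℝ f) :
    ofCols f ∈ orthogonalGroup (Fin m) ℝ :=
  mem_orthogonalGroup_of_orthonormal hf

/-- **Gram–Schmidt deformation**: a continuous family `L : X → GL⁺(m, ℝ)` is homotopic in
`GL⁺(m, ℝ)` to the special orthogonal family of its Gram–Schmidt orthonormalised columns
(Hatcher, *Algebraic Topology*, §3.D: `SO(m)` is a deformation retract of `GL⁺(m, ℝ)`; tree: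
`homotopic_gramSchmidtNormed`). [cite: HatcherAT2002, §3.D] -/
theorem exists_soMap_homotopic (L : C(X, PosMat m)) :
    ∃ Q : C(X, specialOrthogonalGroup (Fin m) ℝ),
      (∀ x, (Q x).1 = ofCols (gramSchmidtNormed ℝ (cols (L x).1))) ∧ L.Homotopic (soMap Q) := by
  -- the column families
  let g : C(X, {f : Fin m → 𝔼 m // LinearIndependent ℝ f}) :=
    ⟨fun x => ⟨cols (L x).1, linearIndependent_cols (L x).2.ne'⟩,
      (continuous_cols.comp (continuous_val.comp L.2)).subtype_mk _⟩
  obtain ⟨g', hg', ⟨H⟩⟩ := homotopic_gramSchmidtNormed g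
  -- determinant along the homotopy is positive
  have hdetne : ∀ p : I × X, (ofCols (H p).1).det ≠ 0 := fun p h0 => by
    have hli : LinearIndependent ℝ (cols (ofCols (H p).1)) := by rw [cols_ofCols]; exact (H p).2
    have : LinearIndependent ℝ (ofCols (H p).1).col := by
      have h2 : (ofCols (H p).1).col = (WithLp.linearEquiv 2 ℝ (Fin m → ℝ)) ∘ cols (ofCols (H p).1) := by
        ext j i; rfl
      rw [h2]; exact hli.map' _ (LinearEquiv.ker _)
    rw [Matrix.linearIndependent_cols_iff_isUnit, Matrix.isUnit_iff_isUnit_det, isUnit_iff_ne_zero] at this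
    exact this h0
  have hcontH : Continuous fun p : I × X => ofCols (H p).1 :=
    continuous_ofCols.comp (continuous_subtype_val.comp H.continuous)
  have hdetpos : ∀ p : I × X, 0 < (ofCols (H p).1).det := by
    rintro ⟨t, x⟩
    -- connectedness of `I` for fixed `x`
    have hc : ContinuousOn (fun s : I => (ofCols (H (s, x)).1).det) univ :=
      ((continuous_id.matrix_det.comp (hcontH.comp (continuous_id.prodMk continuous_const)))).continuousOn
    have h0 : 0 < (ofCols (H (0, x)).1).det := by
      have : (H (0, x)).1 = cols (L x).1 := by rw [H.apply_zero]; rfl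
      rw [this, ofCols_cols]; exact (L x).2
    rcases lt_or_gt_of_ne (hdetne (t, x)) with hlt | hgt
    · exfalso
      have hpc : IsPreconnected (univ : Set I) := isPreconnected_univ
      obtain ⟨s, -, hs⟩ := hpc.intermediate_value₂ (mem_univ t) (mem_univ 0) hc continuousOn_const
        hlt.le h0.le
      exact hdetne (s, x) hs
    · exact hgt
  -- the end family is special orthogonal
  have hQmem : ∀ x, ofCols (g' x).1 ∈ specialOrthogonalGroup (Fin m) ℝ := fun x => by
    rw [mem_specialOrthogonalGroup_iff]
    have horth : ofCols (g' x).1 ∈ orthogonalGroup (Fin m) ℝ := by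
      rw [hg' x]; exact ofCols_mem_orthogonalGroup (gramSchmidtNormed_orthonormal (g x).2)
    refine ⟨horth, ?_⟩
    rcases det_eq_one_or_of_mem_orthogonalGroup horth with h1 | h1
    · exact h1
    · exfalso
      have := hdetpos (1, x)
      rw [H.apply_one, h1] at this
      linarith
  refine ⟨⟨fun x => ⟨ofCols (g' x).1, hQmem x⟩,
      (continuous_ofCols.comp (continuous_subtype_val.comp g'.2)).subtype_mk _⟩, fun x => ?_, ⟨?_⟩⟩
  · change ofCols (g' x).1 = _; rw [hg' x]; rfl
  · exact
      { toFun := fun p => ⟨ofCols (H p).1, hdetpos p⟩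
        continuous_toFun := hcontH.subtype_mk _
        map_zero_left := fun x => Subtype.ext (by
          change ofCols (H (0, x)).1 = (L x).1
          rw [H.apply_zero]; exact ofCols_cols _)
        map_one_left := fun x => Subtype.ext (by
          change ofCols (H (1, x)).1 = ofCols (g' x).1
          rw [H.apply_one]) }

/-- Gram–Schmidt on matrices: orthonormalise the columns. [folklore] -/
def gsMat (A : Matrix (Fin m) (Fin m) ℝ) : Matrix (Fin m) (Fin m) ℝ := ofCols (gramSchmidtNormed ℝ (cols A))

/-- `gsMat` is continuous on `GL⁺`. [folklore] -/
theorem continuous_gsMat_posMat : Continuous fun A : PosMat m => gsMat A.1 := by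
  have h1 : Continuous fun A : PosMat m =>
      (⟨cols A.1, linearIndependent_cols A.2.ne'⟩ : {f : Fin m → 𝔼 m // LinearIndependent ℝ f}) :=
    (continuous_cols.comp continuous_val).subtype_mk _
  have h2 := (continuous_gramSchmidtNormed_subtype (E := 𝔼 m) (ι := Fin m)).comp h1
  exact continuous_ofCols.comp h2

/-- `gsMat` of a matrix of positive determinant is orthogonal. [folklore] -/
theorem gsMat_mem_orthogonalGroup (A : PosMat m) : gsMat A.1 ∈ orthogonalGroup (Fin m) ℝ :=
  ofCols_mem_orthogonalGroup (gramSchmidtNormed_orthonormal (linearIndependent_cols A.2.ne'))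

/-- `gsMat` fixes special orthogonal matrices. [folklore] -/
theorem gsMat_of_mem (A : Matrix (Fin m) (Fin m) ℝ) (hA : A ∈ orthogonalGroup (Fin m) ℝ) : gsMat A = A := by
  have h : Orthonormal ℝ (cols A) := orthonormal_of_mem_orthogonalGroup hA
  unfold gsMat
  rw [gramSchmidtNormed_of_orthonormal h, ofCols_cols]

/-- **A `GL⁺`-null-homotopy of a special orthogonal family can be taken special orthogonal**
(Gram–Schmidt applied to the whole null-homotopy; `X` connected and nonempty). [cite: HatcherAT2002, §3.D] -/
theorem so_nullhomotopic_of_nullhomotopic [PreconnectedSpace X] [Nonempty X]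
    (Q : C(X, specialOrthogonalGroup (Fin m) ℝ)) (h : (soMap Q).Nullhomotopic) : Q.Nullhomotopic := by
  obtain ⟨A, ⟨H⟩⟩ := h
  let G : I × X → Matrix (Fin m) (Fin m) ℝ := fun p => gsMat (H p).1
  have hGc : Continuous G := continuous_gsMat_posMat.comp H.continuous
  have hGO : ∀ p, G p ∈ orthogonalGroup (Fin m) ℝ := fun p => gsMat_mem_orthogonalGroup (H p)
  have hG0 : ∀ x, G (0, x) = (Q x).1 := fun x => by
    have hx : (H (0, x)).1 = (Q x).1 := by rw [H.apply_zero]; rfl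
    change gsMat (H (0, x)).1 = _
    rw [hx]
    exact gsMat_of_mem _ (mem_specialOrthogonalGroup_iff.mp (Q x).2).1
  have hG1 : ∀ x, G (1, x) = gsMat A.1 := fun x => by
    have hx : (H (1, x)).1 = A.1 := by rw [H.apply_one]; rfl
    change gsMat (H (1, x)).1 = _
    rw [hx]
  let x₀ := Classical.arbitrary X
  haveI : PreconnectedSpace I := Subtype.preconnectedSpace isPreconnected_Icc
  have hdet : ∀ p : I × X, (G p).det = 1 := by
    refine det_eq_one_of_preconnectedSpace (K := G) hGc hGO (t₀ := ((0 : I), x₀)) ?_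
    rw [hG0]; exact (mem_specialOrthogonalGroup_iff.mp (Q x₀).2).2
  have hGSO : ∀ p, G p ∈ specialOrthogonalGroup (Fin m) ℝ := fun p =>
    mem_specialOrthogonalGroup_iff.mpr ⟨hGO p, hdet p⟩
  refine ⟨⟨G (1, x₀), hGSO _⟩, ⟨?_⟩⟩
  exact
    { toFun := fun p => ⟨G p, hGSO p⟩
      continuous_toFun := hGc.subtype_mk _
      map_zero_left := fun x => Subtype.ext (hG0 x)
      map_one_left := fun x => Subtype.ext (by
        change G (1, x) = G (1, x₀)
        rw [hG1, hG1]) }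

/-! ### 4. The circle as parameter space: a quotient parametrisation by `[0, 1]` -/

/-- The standard parametrisation `t ↦ (cos 2πt, sin 2πt)` of the circle by `[0, 1]`. [folklore] -/
def qI (t : I) : 𝕊¹ := circlePoint (2 * Real.pi * t)

/-- `qI` is continuous. [folklore] -/
theorem continuous_qI : Continuous qI :=
  continuous_circlePoint.comp (continuous_const.mul continuous_subtype_val)

/-- `qI 0` is the base point `(1, 0)`. [folklore] -/
theorem qI_zero : qI 0 = circlePoint 0 := by simp [qI]

/-- `qI 1` is the base point `(1, 0)`. [folklore] -/
theorem qI_one : qI 1 = circlePoint 0 := by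
  change circlePoint (2 * Real.pi * 1) = _
  rw [mul_one, ← zero_add (2 * Real.pi), circlePoint_add_two_pi]

/-- Equal values of `circlePoint` differ by an integer multiple of `2π`. [folklore] -/
theorem circlePoint_eq_iff {a b : ℝ} : circlePoint a = circlePoint b ↔ ∃ k : ℤ, a - b = 2 * Real.pi * k := by
  constructor
  · intro h
    have hc : Real.cos a = Real.cos b := by
      rw [← circlePoint_apply_zero, ← circlePoint_apply_zero, h]
    have hs : Real.sin a = Real.sin b := by
      rw [← circlePoint_apply_one, ← circlePoint_apply_one, h]
    exact Real.Angle.angle_eq_iff_two_pi_dvd_sub.mp (Real.Angle.cos_sin_inj hc hs)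
  · rintro ⟨k, hk⟩
    rw [show a = b + k * (2 * Real.pi) by linarith]
    exact periodic_circlePoint.int_mul k b

/-- `qI` identifies only the two end points. [folklore] -/
theorem qI_eq_iff {t t' : I} : qI t = qI t' ↔ t = t' ∨ (t = 0 ∧ t' = 1) ∨ (t = 1 ∧ t' = 0) := by
  constructor
  · intro h
    obtain ⟨k, hk⟩ := circlePoint_eq_iff.mp h
    have ht := t.2; have ht' := t'.2
    have hk' : (t : ℝ) - t' = k := by
      have h2 : (2 * Real.pi) * ((t : ℝ) - t') = (2 * Real.pi) * k := by rw [← hk]; ring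
      exact mul_left_cancel₀ (by positivity) h2
    have hlt : |(k : ℝ)| ≤ 1 := by
      rw [← hk', abs_le]; constructor <;> linarith [ht.1, ht.2, ht'.1, ht'.2]
    have hk3 : k = -1 ∨ k = 0 ∨ k = 1 := by
      have : |k| ≤ 1 := by exact_mod_cast hlt
      rcases abs_le.mp this with ⟨h1, h2⟩
      omega
    rcases hk3 with rfl | rfl | rfl
    · right; left
      push_cast at hk'
      constructor <;> apply Subtype.ext <;> simp only [Set.Icc.coe_zero, Set.Icc.coe_one] <;>
        linarith [ht.1, ht.2, ht'.1, ht'.2]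
    · left; apply Subtype.ext; push_cast at hk'; linarith
    · right; right
      push_cast at hk'
      constructor <;> apply Subtype.ext <;> simp only [Set.Icc.coe_zero, Set.Icc.coe_one] <;>
        linarith [ht.1, ht.2, ht'.1, ht'.2]
  · rintro (rfl | ⟨rfl, rfl⟩ | ⟨rfl, rfl⟩)
    · rfl
    · rw [qI_zero, qI_one]
    · rw [qI_zero, qI_one]

/-- `qI` is surjective. [folklore] -/
theorem qI_surjective : Surjective qI := by
  intro u
  obtain ⟨θ, rfl⟩ := circlePoint_surjective u
  obtain ⟨θ', hθ', hθ⟩ := periodic_circlePoint.exists_mem_Ico₀ Real.two_pi_pos θ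
  refine ⟨⟨θ' / (2 * Real.pi), ?_, ?_⟩, ?_⟩
  · exact div_nonneg hθ'.1 Real.two_pi_pos.le
  · rw [div_le_one Real.two_pi_pos]; exact hθ'.2.le
  · change circlePoint (2 * Real.pi * (θ' / (2 * Real.pi))) = circlePoint θ
    rw [mul_div_cancel₀ _ Real.two_pi_pos.ne', hθ]

/-- `qI` is a quotient map (a continuous surjection from a compact space to a Hausdorff space).
[folklore] -/
theorem isQuotientMap_qI : IsQuotientMap qI :=
  (continuous_qI.isClosedMap).isQuotientMap continuous_qI qI_surjective

/-- **Descent of families along `qI`**: a continuous family on `Y × [0, 1]` taking equal values at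
the two ends of the interval is a continuous family on `Y × 𝕊¹`. [folklore] -/
theorem exists_descend_qI {Y Z : Type*} [TopologicalSpace Y] [LocallyCompactSpace Y] [TopologicalSpace Z]
    (g : C(Y × I, Z)) (hg : ∀ y, g (y, 0) = g (y, 1)) :
    ∃ g' : C(Y × 𝕊¹, Z), ∀ y t, g' (y, qI t) = g (y, t) := by
  classical
  -- a set-theoretic section of `qI`
  let sec : 𝕊¹ → I := fun u => Classical.choose (qI_surjective u)
  have hsec : ∀ u, qI (sec u) = u := fun u => Classical.choose_spec (qI_surjective u)
  have hfac : ∀ y t, g (y, sec (qI t)) = g (y, t) := fun y t => by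
    rcases qI_eq_iff.mp (hsec (qI t)) with h | ⟨h1, h2⟩ | ⟨h1, h2⟩
    · rw [h]
    · rw [h1, h2, hg]
    · rw [h1, h2, hg]
  let g' : Y × 𝕊¹ → Z := fun p => g (p.1, sec p.2)
  have hc : Continuous g' := by
    refine isQuotientMap_qI.continuous_lift_prod_right (g := g') ?_
    have : (fun p : Y × I => g' (p.1, qI p.2)) = g := by
      funext p; exact hfac p.1 p.2
    rw [this]; exact g.continuous
  exact ⟨⟨g', hc⟩, fun y t => hfac y t⟩

/-! ### 5. Inverses in `SO(N)` -/

section SO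

variable {N : ℕ}

/-- Inversion on `SO(N)` is continuous (it is transposition). [folklore] -/
theorem continuous_soInv : Continuous fun A : specialOrthogonalGroup (Fin N) ℝ => A⁻¹ := by
  rw [continuous_induced_rng]
  change Continuous fun A : specialOrthogonalGroup (Fin N) ℝ => (A.1)ᴴ
  exact continuous_subtype_val.matrix_conjTranspose

/-- `ι` is a monoid map: inverses. [folklore] -/
theorem inclSO_inv (A : specialOrthogonalGroup (Fin N) ℝ) : inclSO A⁻¹ = (inclSO A)⁻¹ := by
  have h : inclSO A⁻¹ * inclSO A = 1 := by rw [← inclSO_mul, inv_mul_cancel, inclSO_one]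
  exact eq_inv_of_mul_eq_one_left h

end SO

/-! ### 6. Stabilisation of free loops in `SO`: onto for `D ≥ 2`, one-to-one for `D ≥ 3` -/

section Stability

variable {D : ℕ}

/-- The unit sphere of `𝔼 (D + 1)` is path connected for `D ≥ 1`. [folklore] -/
theorem pathConnectedSpace_sphere (hD : 1 ≤ D) :
    PathConnectedSpace (sphere (0 : EuclideanSpace ℝ (Fin (D + 1))) 1) := by
  rw [← isPathConnected_iff_pathConnectedSpace]
  refine isPathConnected_sphere ?_ 0 zero_le_one
  rw [← Module.finrank_eq_rank, finrank_euclideanSpace_fin]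
  exact_mod_cast Nat.lt_succ_of_le hD

/-- **Every loop in the `D`-sphere is freely null-homotopic** (`D ≥ 2`, `π₁(𝕊ᴰ) = 0`).
[cite: HatcherAT2002, §4.1, p. 346] -/
theorem homotopic_const_sphereLoop (hD : 2 ≤ D) (f : C(𝕊¹, sphere (0 : EuclideanSpace ℝ (Fin (D + 1))) 1))
    (y₀ : sphere (0 : EuclideanSpace ℝ (Fin (D + 1))) 1) :
    f.Homotopic (ContinuousMap.const _ y₀) := by
  haveI := pathConnectedSpace_sphere (D := D) (by omega)
  refine homotopic_const_of_sphere_of_subsingleton_homotopyGroup (E := EuclideanSpace ℝ (Fin (1 + 1))) (m := 1)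
    finrank_euclideanSpace_fin (fun _ y => ?_) f y₀
  exact subsingleton_homotopyGroup_sphere (by rw [finrank_euclideanSpace_fin]; omega) y

/-- **Surjectivity of stabilisation on free loops**: every loop in `SO(D + 1)`, `D ≥ 2`, is freely
homotopic to the stabilisation `ι ∘ k` of a loop in `SO(D)` (transport along a null-homotopy of
the projected loop in `𝕊ᴰ`; Hatcher §4.2, Example 4.55). [cite: HatcherAT2002, §4.2, Example 4.55] -/
theorem exists_homotopic_inclSO (hD : 2 ≤ D) (Q : C(𝕊¹, specialOrthogonalGroup (Fin (D + 1)) ℝ)) :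
    ∃ k : C(𝕊¹, specialOrthogonalGroup (Fin D) ℝ), Q.Homotopic (inclSO.comp k) := by
  let G₀ : C(𝕊¹, sphere (0 : EuclideanSpace ℝ (Fin (D + 1))) 1) := ⟨fun u => proj (Q u), continuous_proj.comp Q.2⟩
  obtain ⟨H⟩ := homotopic_const_sphereLoop hD G₀ (pole D)
  obtain ⟨Φ, hΦ0, hΦr, -⟩ := exists_transport (Y := 𝕊¹) H.toContinuousMap
  change ∀ s y, rot (Φ (s, y)) (H (0, y)) = H (s, y) at hΦr
  -- the transported family `F (s, u) = Φ (s, u) Q u`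
  let F : C(I × 𝕊¹, specialOrthogonalGroup (Fin (D + 1)) ℝ) :=
    ⟨fun p => Φ p * Q p.2, Φ.continuous.mul (Q.continuous.comp continuous_snd)⟩
  have hF1 : ∀ u, proj (F (1, u)) = pole D := fun u => by
    change proj (Φ (1, u) * Q u) = pole D
    rw [proj_mul, show proj (Q u) = H (0, u) by rw [H.apply_zero]; rfl, hΦr, H.apply_one]; rfl
  let f₁ : C(𝕊¹, specialOrthogonalGroup (Fin (D + 1)) ℝ) := ⟨fun u => F (1, u), F.continuous.comp (continuous_const.prodMk continuous_id)⟩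
  obtain ⟨k, hk⟩ := exists_comp_inclSO_eq f₁ hF1
  refine ⟨k, ⟨?_⟩⟩
  exact
    { toFun := fun p => F p
      continuous_toFun := F.continuous
      map_zero_left := fun u => by
        change Φ (0, u) * Q u = Q u
        rw [hΦ0, one_mul]
      map_one_left := fun u => by
        change F (1, u) = inclSO (k u)
        rw [hk]; rfl }

/-- **Injectivity of stabilisation on free loops**: a loop `k` in `SO(D)`, `D ≥ 3`, whose
stabilisation `ι ∘ k` is freely null-homotopic in `SO(D + 1)` is freely null-homotopic in `SO(D)`
(Hatcher §4.2, Example 4.55: `π₁ SO(D) → π₁ SO(D + 1)` is injective as `π₂(𝕊ᴰ) = 0`; the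
null-homotopy, based by the group structure, projects to a map of the cylinder which is the pole
on its boundary, contracts rel boundary, and is transported into the stabiliser).
[cite: HatcherAT2002, §4.2, Example 4.55 with Prop. 4.48] -/
theorem nullhomotopic_of_inclSO (hD : 3 ≤ D) (k : C(𝕊¹, specialOrthogonalGroup (Fin D) ℝ))
    (h : (inclSO.comp k).Nullhomotopic) : k.Nullhomotopic := by
  obtain ⟨A, ⟨H⟩⟩ := h
  let θ₀ : 𝕊¹ := circlePoint 0
  -- base the null-homotopy by the group structure
  let K : C(I × 𝕊¹, specialOrthogonalGroup (Fin (D + 1)) ℝ) :=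
    ⟨fun p => (H (p.1, θ₀))⁻¹ * H p,
      (continuous_soInv.comp (H.continuous.comp (continuous_fst.prodMk continuous_const))).mul H.continuous⟩
  have hK0 : ∀ u, K (0, u) = inclSO ((k θ₀)⁻¹ * k u) := fun u => by
    change (H (0, θ₀))⁻¹ * H (0, u) = _
    rw [H.apply_zero, H.apply_zero, inclSO_mul, inclSO_inv]; rfl
  have hK1 : ∀ u, K (1, u) = 1 := fun u => by
    change (H (1, θ₀))⁻¹ * H (1, u) = 1
    rw [H.apply_one, H.apply_one]; exact inv_mul_cancel _
  have hKθ : ∀ s, K (s, θ₀) = 1 := fun s => inv_mul_cancel _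
  -- the projected map of the cylinder is the pole on the boundary
  let φ : C(I × (Fin 1 → I), sphere (0 : EuclideanSpace ℝ (Fin (D + 1))) 1) :=
    ⟨fun z => proj (K (z.1, qI (z.2 0))),
      continuous_proj.comp (K.continuous.comp (continuous_fst.prodMk
        (continuous_qI.comp ((continuous_apply 0).comp continuous_snd))))⟩
  have hφ : ∀ z ∈ GenLoopPath.cylBd (Fin 1), φ z = pole D := by
    rintro ⟨s, t⟩ hz
    change proj (K (s, qI (t 0))) = pole D
    rcases hz with h0 | h1 | ht
    · change s = 0 at h0; subst h0; rw [hK0]; exact proj_inclSO _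
    · change s = 1 at h1; subst h1; rw [hK1]; exact proj_one
    · obtain ⟨i, hi⟩ := ht
      have hi' : t 0 = 0 ∨ t 0 = 1 := by
        have : i = 0 := Subsingleton.elim _ _
        subst this; exact hi
      have hq : qI (t 0) = θ₀ := by
        rcases hi' with h | h
        · rw [h]; exact qI_zero
        · rw [h]; exact qI_one
      rw [hq, hKθ]; exact proj_one
  have hS : Subsingleton (HomotopyGroup (Fin 2) (sphere (0 : EuclideanSpace ℝ (Fin (D + 1))) 1) (pole D)) :=
    subsingleton_homotopyGroup_sphere (by rw [finrank_euclideanSpace_fin]; omega) _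
  obtain ⟨𝒦⟩ := nonempty_homotopyRel_cylBd_of_subsingleton (n := 1) hS φ hφ
  -- transport along the contraction
  obtain ⟨Φ, -, hΦr, hΦs⟩ := exists_transport (Y := I × (Fin 1 → I)) 𝒦.toContinuousMap
  change ∀ r z, rot (Φ (r, z)) (𝒦 (0, z)) = 𝒦 (r, z) at hΦr
  change ∀ z, (∀ r, 𝒦 (r, z) = 𝒦 (0, z)) → ∀ r, Φ (r, z) = 1 at hΦs
  have hΦbd : ∀ z ∈ GenLoopPath.cylBd (Fin 1), Φ (1, z) = 1 := fun z hz =>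
    hΦs z (fun r => by rw [𝒦.eq_fst r hz, 𝒦.apply_zero]) 1
  let M₁ : C(I × (Fin 1 → I), specialOrthogonalGroup (Fin (D + 1)) ℝ) :=
    ⟨fun z => Φ (1, z) * K (z.1, qI (z.2 0)),
      (Φ.continuous.comp (continuous_const.prodMk continuous_id)).mul
        (K.continuous.comp (continuous_fst.prodMk (continuous_qI.comp ((continuous_apply 0).comp continuous_snd))))⟩
  have hM₁ : ∀ z, proj (M₁ z) = pole D := fun z => by
    change proj (Φ (1, z) * K (z.1, qI (z.2 0))) = pole D
    rw [proj_mul, show proj (K (z.1, qI (z.2 0))) = 𝒦 (0, z) by rw [𝒦.apply_zero]; rfl, hΦr, 𝒦.apply_one]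
    rfl
  obtain ⟨k₁, hk₁⟩ := exists_comp_inclSO_eq M₁ hM₁
  -- values of `k₁` on the boundary of the cylinder
  have hk₁bd : ∀ z ∈ GenLoopPath.cylBd (Fin 1), inclSO (k₁ z) = K (z.1, qI (z.2 0)) := fun z hz => by
    rw [hk₁]; change Φ (1, z) * K (z.1, qI (z.2 0)) = _; rw [hΦbd z hz, one_mul]
  have hk₁0 : ∀ t : Fin 1 → I, k₁ (0, t) = (k θ₀)⁻¹ * k (qI (t 0)) := fun t => by
    apply inclSO_injective
    rw [hk₁bd (0, t) (Or.inl rfl)]; exact hK0 _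
  have hk₁1 : ∀ t : Fin 1 → I, k₁ (1, t) = 1 := fun t => by
    apply inclSO_injective
    rw [hk₁bd (1, t) (Or.inr (Or.inl rfl)), inclSO_one]; exact hK1 _
  have hk₁s : ∀ (s : I) (t : Fin 1 → I), (t 0 = 0 ∨ t 0 = 1) → k₁ (s, t) = 1 := fun s t ht => by
    apply inclSO_injective
    have hz : ((s, t) : I × (Fin 1 → I)) ∈ GenLoopPath.cylBd (Fin 1) := Or.inr (Or.inr ⟨0, ht⟩)
    rw [hk₁bd (s, t) hz, inclSO_one]
    have hq : qI (t 0) = θ₀ := by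
      rcases ht with h | h
      · rw [h]; exact qI_zero
      · rw [h]; exact qI_one
    change K (s, qI (t 0)) = 1
    rw [hq]; exact hKθ s
  -- descend to `I × 𝕊¹`
  let g : C(I × I, specialOrthogonalGroup (Fin D) ℝ) :=
    ⟨fun p => k₁ (p.1, fun _ => p.2), k₁.continuous.comp (continuous_fst.prodMk (continuous_pi fun _ => continuous_snd))⟩
  have hg : ∀ s, g (s, 0) = g (s, 1) := fun s => by
    change k₁ (s, fun _ => 0) = k₁ (s, fun _ => 1)
    rw [hk₁s s _ (Or.inl rfl), hk₁s s _ (Or.inr rfl)]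
  obtain ⟨g', hg'⟩ := exists_descend_qI g hg
  -- `u ↦ (k θ₀)⁻¹ k u` is null-homotopic, hence so is `k`
  have hnull : (⟨fun u => (k θ₀)⁻¹ * k u, continuous_const.mul k.continuous⟩ :
      C(𝕊¹, specialOrthogonalGroup (Fin D) ℝ)).Homotopic (ContinuousMap.const _ 1) := by
    refine ⟨{ toFun := fun p => g' p,
              continuous_toFun := g'.continuous,
              map_zero_left := fun u => ?_,
              map_one_left := fun u => ?_ }⟩
    · obtain ⟨t, rfl⟩ := qI_surjective u
      rw [hg']; change k₁ (0, fun _ => t) = (k θ₀)⁻¹ * k (qI t); exact hk₁0 _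
    · obtain ⟨t, rfl⟩ := qI_surjective u
      rw [hg']; change k₁ (1, fun _ => t) = 1; exact hk₁1 _
  obtain ⟨G⟩ := hnull
  refine ⟨k θ₀, ⟨{ toFun := fun p => k θ₀ * G p,
                    continuous_toFun := continuous_const.mul G.continuous,
                    map_zero_left := fun u => ?_,
                    map_one_left := fun u => ?_ }⟩⟩
  · rw [G.apply_zero]; change k θ₀ * ((k θ₀)⁻¹ * k u) = k u; rw [mul_inv_cancel_left]
  · rw [G.apply_one]; change k θ₀ * 1 = k θ₀; rw [mul_one]

end Stability

/-! ### 7. Stabilisation of free loops in `GL⁺(m, ℝ)` -/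

section GLStability

/-- The circle is nonempty. [folklore] -/
instance : Nonempty 𝕊¹ := ⟨circlePoint 0⟩

/-- The circle is preconnected. [folklore] -/
instance : PreconnectedSpace 𝕊¹ := by
  haveI := pathConnectedSpace_sphere (D := 1) le_rfl
  infer_instance

/-- Homotopies are compatible with `soMap`. [folklore] -/
theorem Homotopic.soMap {Q Q' : C(X, specialOrthogonalGroup (Fin m) ℝ)} (h : Q.Homotopic Q') :
    (soMap Q).Homotopic (soMap Q') := by
  obtain ⟨H⟩ := h
  exact ⟨{ toFun := fun p => ofSO (H p),
           continuous_toFun := continuous_ofSO.comp H.continuous,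
           map_zero_left := fun x => by simp,
           map_one_left := fun x => by simp }⟩

/-- Null-homotopy passes along homotopies. [folklore] -/
theorem nullhomotopic_of_homotopic {Y : Type*} [TopologicalSpace Y] {f g : C(X, Y)} (hf : f.Nullhomotopic)
    (h : f.Homotopic g) : g.Nullhomotopic := by
  obtain ⟨y, hy⟩ := hf
  exact ⟨y, h.symm.trans hy⟩

/-- **Every free loop in `GL⁺(m + 1, ℝ)`, `m ≥ 2`, is homotopic to a stabilised loop.**
[cite: HatcherAT2002, §4.2, Example 4.55; §3.D] -/
theorem exists_homotopic_stabMap (hm : 2 ≤ m) (L : C(𝕊¹, PosMat (m + 1))) :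
    ∃ L₀ : C(𝕊¹, PosMat m), L.Homotopic (stabMap L₀) := by
  obtain ⟨Q, -, hQ⟩ := exists_soMap_homotopic L
  obtain ⟨k, hk⟩ := exists_homotopic_inclSO hm Q
  exact ⟨soMap k, hQ.trans (Homotopic.soMap hk)⟩

/-- **A free loop in `GL⁺(m, ℝ)`, `m ≥ 3`, is null-homotopic iff its stabilisation is.**
[cite: HatcherAT2002, §4.2, Example 4.55; §3.D] -/
theorem nullhomotopic_stabMap_iff (hm : 3 ≤ m) (L : C(𝕊¹, PosMat m)) :
    (stabMap L).Nullhomotopic ↔ L.Nullhomotopic := by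
  constructor
  · intro h
    obtain ⟨Q, -, hQ⟩ := exists_soMap_homotopic L
    have h1 : (stabMap (soMap Q)).Nullhomotopic := nullhomotopic_of_homotopic h (Homotopic.stabMap hQ)
    rw [stabMap_soMap] at h1
    have h2 : (inclSO.comp Q).Nullhomotopic := so_nullhomotopic_of_nullhomotopic _ h1
    have h3 : Q.Nullhomotopic := nullhomotopic_of_inclSO hm Q h2
    obtain ⟨A, hA⟩ := h3
    exact ⟨ofSO A, hQ.trans (Homotopic.soMap hA)⟩
  · rintro ⟨A, hA⟩
    exact ⟨stab A, Homotopic.stabMap hA⟩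

end GLStability

/-! ### 8. Operators on `𝔼 3` and `3 × 3` matrices: continuity in the product topology -/

section Operators

/-- `toMat` is continuous into the product topology of matrices. [folklore] -/
theorem continuous_toMat_pi : Continuous fun f : 𝔼 3 →L[ℝ] 𝔼 3 => (toMat f : Matrix (Fin 3) (Fin 3) ℝ) := by
  refine continuous_matrix fun i j => ?_
  simp_rw [OpLoop.toMat_apply_eq]
  exact ((PiLp.continuous_apply 2 _ i).comp ((ContinuousLinearMap.apply ℝ (𝔼 3) (EuclideanSpace.single j 1)).continuous))

/-- `matCLM` is continuous from the product topology of matrices. [folklore] -/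
theorem continuous_matCLM_pi : Continuous fun N : Matrix (Fin 3) (Fin 3) ℝ => matCLM N :=
  (Matrix.toEuclideanCLM (n := Fin 3) (𝕜 := ℝ)).toAlgEquiv.toLinearMap.continuous_of_finiteDimensional

/-- The open set of operators of positive determinant. [folklore] -/
theorem isOpen_det_pos : IsOpen {f : 𝔼 3 →L[ℝ] 𝔼 3 | 0 < LinearMap.det (f : 𝔼 3 →ₗ[ℝ] 𝔼 3)} :=
  isOpen_lt continuous_const OpLoop.continuous_det_clm

/-- **Uniform room around a compact family of operators of positive determinant**: there is
`ε > 0` such that every operator within `ε` of the family has positive determinant. [folklore] -/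
theorem exists_eps_det_pos {K : Set (𝔼 3 →L[ℝ] 𝔼 3)} (hK : IsCompact K)
    (hpos : ∀ f ∈ K, 0 < LinearMap.det (f : 𝔼 3 →ₗ[ℝ] 𝔼 3)) :
    ∃ ε > 0, ∀ f ∈ K, ∀ g : 𝔼 3 →L[ℝ] 𝔼 3, dist g f < ε → 0 < LinearMap.det (g : 𝔼 3 →ₗ[ℝ] 𝔼 3) := by
  obtain ⟨ε, hε, hsub⟩ := hK.exists_thickening_subset_open isOpen_det_pos (fun f hf => hpos f hf)
  refine ⟨ε, hε, fun f hf g hg => ?_⟩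
  exact hsub (mem_thickening_iff.mpr ⟨f, hf, hg⟩)

end Operators

/-! ### 9. The twisted loop and the dichotomy in `GL⁺(3, ℝ)`; smooth loops -/

section Dichotomy

open OpLoop

/-- The matrix loop of a smooth loop of operators of positive determinant. [folklore] -/
def matLoop (L : OpLoop) (hL : ∀ u, 0 < LinearMap.det (L.toFun u : 𝔼 3 →ₗ[ℝ] 𝔼 3)) : C(𝕊¹, PosMat 3) :=
  ⟨fun u => ⟨toMat (L.toFun u), by rw [det_toMat]; exact hL u⟩,
    (continuous_toMat_pi.comp L.contMDiff_toFun.continuous).subtype_mk _⟩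

/-- Values of `matLoop`. [folklore] -/
@[simp] theorem matLoop_apply_val (L : OpLoop) (hL : ∀ u, 0 < LinearMap.det (L.toFun u : 𝔼 3 →ₗ[ℝ] 𝔼 3)) (u : 𝕊¹) :
    (matLoop L hL u).1 = toMat (L.toFun u) := rfl

/-- The constant loop `1` has positive determinant. [folklore] -/
theorem det_pos_one (u : 𝕊¹) : 0 < LinearMap.det (one.toFun u : 𝔼 3 →ₗ[ℝ] 𝔼 3) := by
  change 0 < LinearMap.det ((1 : 𝔼 3 →L[ℝ] 𝔼 3) : 𝔼 3 →ₗ[ℝ] 𝔼 3)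
  rw [show ((1 : 𝔼 3 →L[ℝ] 𝔼 3) : 𝔼 3 →ₗ[ℝ] 𝔼 3) = 1 from rfl, map_one]; exact one_pos

/-- The twisted loop has positive determinant (`det rot(u) = 1`). [folklore] -/
theorem det_pos_twist (u : 𝕊¹) : 0 < LinearMap.det (twist.toFun u : 𝔼 3 →ₗ[ℝ] 𝔼 3) := by
  change 0 < LinearMap.det ((matCLM (OpLoop.rotMat (u : 𝔼 2))) : 𝔼 3 →ₗ[ℝ] 𝔼 3)
  rw [det_matCLM]
  have hu := OpLoop.sq_add_sq_of_mem_sphere u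
  have : (OpLoop.rotMat (u : 𝔼 2)).det = 1 := by
    rw [OpLoop.rotMat, Matrix.det_fin_three]; simp; nlinarith [hu]
  rw [this]; exact one_pos

/-- The constant loop `1`. [folklore] -/
theorem matLoop_one : matLoop one det_pos_one = ContinuousMap.const 𝕊¹ (1 : PosMat 3) := by
  ext u; apply Subtype.ext
  change toMat (1 : 𝔼 3 →L[ℝ] 𝔼 3) = 1
  exact toMat_one

/-- **The twisted loop** `u ↦ rot(u) ⊕ 1` in `GL⁺(3, ℝ)` (one full turn of a plane), as a free
continuous loop; and its stabilisations `τₘ` in `GL⁺(m + 3, ℝ)`. [cite: GompfStipsiczGSM1999, §5.2] -/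
def tau : (m : ℕ) → C(𝕊¹, PosMat (m + 3))
  | 0 => matLoop twist det_pos_twist
  | m + 1 => stabMap (tau m)

/-- `τ₀` is the matrix loop of the twist. [folklore] -/
theorem tau_zero : tau 0 = matLoop twist det_pos_twist := rfl

/-- `τₘ₊₁` is the stabilisation of `τₘ`. [folklore] -/
theorem tau_succ (m : ℕ) : tau (m + 1) = stabMap (tau m) := rfl

/-- Products of matrix loops. [folklore] -/
theorem matLoop_mul (L L' : OpLoop) (hL : ∀ u, 0 < LinearMap.det (L.toFun u : 𝔼 3 →ₗ[ℝ] 𝔼 3))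
    (hL' : ∀ u, 0 < LinearMap.det (L'.toFun u : 𝔼 3 →ₗ[ℝ] 𝔼 3))
    (hLL' : ∀ u, 0 < LinearMap.det ((L.mul L').toFun u : 𝔼 3 →ₗ[ℝ] 𝔼 3)) :
    matLoop (L.mul L') hLL' = matLoop L hL * matLoop L' hL' := by
  ext u; apply Subtype.ext
  change toMat (L.toFun u * L'.toFun u) = toMat (L.toFun u) * toMat (L'.toFun u)
  exact toMat_mul _ _

/-- **A `Joined` family of smooth loops gives a free homotopy of matrix loops.**
[cite: GompfStipsiczGSM1999, §5.2] -/
theorem homotopic_matLoop_of_joined {L L' : OpLoop} (h : Joined L L')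
    (hL : ∀ u, 0 < LinearMap.det (L.toFun u : 𝔼 3 →ₗ[ℝ] 𝔼 3))
    (hL' : ∀ u, 0 < LinearMap.det (L'.toFun u : 𝔼 3 →ₗ[ℝ] 𝔼 3)) :
    (matLoop L hL).Homotopic (matLoop L' hL') := by
  obtain ⟨F, hF, hFi, h0, h1⟩ := h
  -- positivity of the determinant along the family
  have hdet : ∀ t ∈ Icc (0 : ℝ) 1, ∀ u, 0 < LinearMap.det ((F t).toFun u : 𝔼 3 →ₗ[ℝ] 𝔼 3) := by
    intro t ht u
    have hmaps : MapsTo (fun p : ℝ × 𝕊¹ => (p.1 * t, p.2)) (Icc 0 1 ×ˢ univ) (Icc 0 1 ×ˢ univ) := by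
      rintro ⟨s, v⟩ ⟨hs, -⟩
      exact ⟨⟨mul_nonneg hs.1 ht.1, mul_le_one₀ hs.2 ht.1 ht.2⟩, mem_univ _⟩
    have hc : Continuous fun p : ℝ × 𝕊¹ => (p.1 * t, p.2) := (continuous_fst.mul continuous_const).prodMk continuous_snd
    have hJ : Joined L (F t) :=
      ⟨fun s => F (s * t), hF.comp hc.continuousOn hmaps, hFi.comp hc.continuousOn hmaps, by simp [h0], by simp⟩
    exact hJ.det_pos u (hL u)
  refine ⟨{ toFun := fun p => ⟨toMat ((F p.1).toFun p.2), by rw [det_toMat]; exact hdet p.1 p.1.2 p.2⟩,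
            continuous_toFun := ?_,
            map_zero_left := fun u => Subtype.ext (by simp [h0]),
            map_one_left := fun u => Subtype.ext (by simp [h1]) }⟩
  refine Continuous.subtype_mk (continuous_toMat_pi.comp ?_) _
  exact hF.comp_continuous (continuous_subtype_val.prodMap continuous_id) fun p => ⟨p.1.2, mem_univ _⟩

/-- **`τ₃ · τ₃` is null-homotopic** (`π₁ SO(3)` has order at most two: the tree's quaternion
computation `OpLoop.joined_twist_mul_twist_one`). [cite: GompfStipsiczGSM1999, §5.2] -/
theorem nullhomotopic_tau_zero_mul : (tau 0 * tau 0).Nullhomotopic := by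
  have hdet : ∀ u, 0 < LinearMap.det ((twist.mul twist).toFun u : 𝔼 3 →ₗ[ℝ] 𝔼 3) := fun u => by
    change 0 < LinearMap.det ((twist.toFun u * twist.toFun u : 𝔼 3 →L[ℝ] 𝔼 3) : 𝔼 3 →ₗ[ℝ] 𝔼 3)
    rw [ContinuousLinearMap.toLinearMap_mul, map_mul]
    exact mul_pos (det_pos_twist u) (det_pos_twist u)
  have h1 := homotopic_matLoop_of_joined joined_twist_mul_twist_one hdet det_pos_one
  rw [matLoop_mul twist twist det_pos_twist det_pos_twist hdet, matLoop_one] at h1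
  exact ⟨1, h1⟩

/-- `τₘ · τₘ` is null-homotopic for every `m`. [folklore] -/
theorem nullhomotopic_tau_mul (m : ℕ) : (tau m * tau m).Nullhomotopic := by
  induction m with
  | zero => exact nullhomotopic_tau_zero_mul
  | succ m ih =>
    obtain ⟨A, hA⟩ := ih
    refine ⟨stab A, ?_⟩
    have : tau (m + 1) * tau (m + 1) = stabMap (tau m * tau m) := by
      ext u : 1
      change stab (tau m u) * stab (tau m u) = stab (tau m u * tau m u)
      rw [stab_mul]
    rw [this]
    exact Homotopic.stabMap hA

/-- **The dichotomy in `GL⁺(3, ℝ)`**: every free continuous loop is null-homotopic or homotopic to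
the twisted loop (smooth approximation within `GL⁺`, then the tree's classification of smooth loops
`OpLoop.exists_joined_one_or_twist`: first column made constant by a rotation field after it misses
a direction, block form, winding number of the `SO(2)`-block, parity by quaternions).
[cite: GompfStipsiczGSM1999, §5.2 (π₁SO(3) = ℤ/2: two framings)] -/
theorem nullhomotopic_or_homotopic_tau_zero (L : C(𝕊¹, PosMat 3)) :
    L.Nullhomotopic ∨ L.Homotopic (tau 0) := by
  -- the operator loop and a uniform room
  let g : 𝕊¹ → (𝔼 3 →L[ℝ] 𝔼 3) := fun u => matCLM (L u).1
  have hgc : Continuous g := continuous_matCLM_pi.comp (continuous_val.comp L.2)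
  have hgdet : ∀ u, 0 < LinearMap.det (g u : 𝔼 3 →ₗ[ℝ] 𝔼 3) := fun u => by
    change 0 < LinearMap.det ((matCLM (L u).1 : 𝔼 3 →L[ℝ] 𝔼 3) : 𝔼 3 →ₗ[ℝ] 𝔼 3)
    rw [det_matCLM]; exact (L u).2
  obtain ⟨ε, hε, hroom⟩ := exists_eps_det_pos (isCompact_range hgc) (by rintro _ ⟨u, rfl⟩; exact hgdet u)
  -- smooth approximation
  obtain ⟨g', hg', -⟩ := hgc.exists_contMDiff_approx (𝓡 1) (⊤ : ℕ∞) continuous_const (fun _ : 𝕊¹ => hε)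
  have hg's : ContMDiff (𝓡 1) 𝓘(ℝ, 𝔼 3 →L[ℝ] 𝔼 3) ∞ g' := g'.contMDiff
  -- the segment from `g` to `g'` stays in `GL⁺`
  have hseg : ∀ (t : ℝ), t ∈ Icc (0 : ℝ) 1 → ∀ u,
      0 < LinearMap.det (((1 - t) • g u + t • g' u : 𝔼 3 →L[ℝ] 𝔼 3) : 𝔼 3 →ₗ[ℝ] 𝔼 3) := by
    intro t ht u
    refine hroom (g u) ⟨u, rfl⟩ _ ?_
    have : (1 - t) • g u + t • g' u - g u = t • (g' u - g u) := by
      have h1 : (1 - t) • g u = g u - t • g u := by rw [sub_smul (1 : ℝ) t (g u), one_smul]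
      rw [h1, smul_sub]; abel
    rw [dist_eq_norm, this, norm_smul, Real.norm_eq_abs, abs_of_nonneg ht.1]
    calc t * ‖g' u - g u‖ ≤ 1 * ‖g' u - g u‖ := by gcongr; exact ht.2
      _ = dist (g' u) (g u) := by rw [_root_.one_mul, dist_eq_norm]
      _ < ε := hg' u
  have hg'det : ∀ u, 0 < LinearMap.det (g' u : 𝔼 3 →ₗ[ℝ] 𝔼 3) := fun u => by
    simpa using hseg 1 ⟨zero_le_one, le_rfl⟩ u
  -- the smooth loop
  let Ls : OpLoop := ofUnits g' hg's fun u => isUnit_of_det_ne_zero (hg'det u).ne'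
  have hLs : ∀ u, 0 < LinearMap.det (Ls.toFun u : 𝔼 3 →ₗ[ℝ] 𝔼 3) := hg'det
  -- `L` is homotopic to the matrix loop of `Ls`
  have hhom : L.Homotopic (matLoop Ls hLs) := by
    refine ⟨{ toFun := fun p => ⟨toMat ((1 - (p.1 : ℝ)) • g p.2 + (p.1 : ℝ) • g' p.2),
                by rw [det_toMat]; exact hseg p.1 p.1.2 p.2⟩,
              continuous_toFun := ?_,
              map_zero_left := fun u => Subtype.ext ?_,
              map_one_left := fun u => Subtype.ext ?_ }⟩
    · refine Continuous.subtype_mk (continuous_toMat_pi.comp ?_) _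
      have ht : Continuous fun p : I × 𝕊¹ => (p.1 : ℝ) := continuous_subtype_val.comp continuous_fst
      exact ((continuous_const.sub ht).smul (hgc.comp continuous_snd)).add
        (ht.smul (hg's.continuous.comp continuous_snd))
    · change toMat ((1 - (0 : ℝ)) • g u + (0 : ℝ) • g' u) = (L u).1
      simp [g]
    · change toMat ((1 - (1 : ℝ)) • g u + (1 : ℝ) • g' u) = toMat (Ls.toFun u)
      simp [Ls]
  -- classification of the smooth loop
  rcases exists_joined_one_or_twist Ls (hLs ptA) with hJ | hJ
  · left
    have h2 := homotopic_matLoop_of_joined hJ hLs det_pos_one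
    rw [matLoop_one] at h2
    exact ⟨1, hhom.trans h2⟩
  · right
    exact hhom.trans (homotopic_matLoop_of_joined hJ hLs det_pos_twist)

/-- **The dichotomy in `GL⁺(m, ℝ)`, `m ≥ 3`**: every free loop is null-homotopic or homotopic to
the (stabilised) twisted loop `τ`. [cite: HatcherAT2002, §4.2, Example 4.55] -/
theorem nullhomotopic_or_homotopic_tau (m : ℕ) (L : C(𝕊¹, PosMat (m + 3))) :
    L.Nullhomotopic ∨ L.Homotopic (tau m) := by
  induction m with
  | zero => exact nullhomotopic_or_homotopic_tau_zero L
  | succ m ih =>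
    obtain ⟨L₀, hL₀⟩ := exists_homotopic_stabMap (m := m + 3) (by omega) L
    rcases ih L₀ with h | h
    · left
      obtain ⟨A, hA⟩ := h
      exact ⟨stab A, hL₀.trans (Homotopic.stabMap hA)⟩
    · right
      exact hL₀.trans (Homotopic.stabMap h)

end Dichotomy

/-! ### 10. The class `cls L ∈ ℤ/2` of a free loop and its algebra -/

section Cls

open Classical in
/-- **The class of a free loop in `GL⁺(m, ℝ)`**: `0` if the loop is null-homotopic, `1` otherwise.
For `m ≥ 3` this is the class in `π₁ GL⁺(m, ℝ)`, a group of order at most two generated by the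
twisted loop (no use is ever made of its non-triviality). [cite: GompfStipsiczGSM1999, §5.2] -/
def cls (L : C(𝕊¹, PosMat m)) : ZMod 2 := if L.Nullhomotopic then 0 else 1

/-- Class `0` means null-homotopic. [folklore] -/
theorem cls_eq_zero_iff (L : C(𝕊¹, PosMat m)) : cls L = 0 ↔ L.Nullhomotopic := by
  unfold cls; split_ifs with h
  · simp [h]
  · simp [h]

/-- Class `1` means not null-homotopic. [folklore] -/
theorem cls_eq_one_iff (L : C(𝕊¹, PosMat m)) : cls L = 1 ↔ ¬ L.Nullhomotopic := by
  unfold cls; split_ifs with h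
  · simp [h]
  · simp [h]

/-- Null-homotopic loops have class `0`. [folklore] -/
theorem cls_of_nullhomotopic {L : C(𝕊¹, PosMat m)} (h : L.Nullhomotopic) : cls L = 0 := (cls_eq_zero_iff L).mpr h

/-- Constant loops have class `0`. [folklore] -/
@[simp] theorem cls_const (A : PosMat m) : cls (ContinuousMap.const 𝕊¹ A) = 0 :=
  cls_of_nullhomotopic ⟨A, ContinuousMap.Homotopic.refl _⟩

/-- Homotopic loops have the same class. [folklore] -/
theorem cls_congr {L L' : C(𝕊¹, PosMat m)} (h : L.Homotopic L') : cls L = cls L' := by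
  by_cases hL : L.Nullhomotopic
  · rw [cls_of_nullhomotopic hL, cls_of_nullhomotopic (nullhomotopic_of_homotopic hL h)]
  · have hL' : ¬ L'.Nullhomotopic := fun h' => hL (nullhomotopic_of_homotopic h' h.symm)
    rw [(cls_eq_one_iff L).mpr hL, (cls_eq_one_iff L').mpr hL']

/-- Stabilisation does not change the class (`m ≥ 3`). [cite: HatcherAT2002, §4.2, Example 4.55] -/
theorem cls_stabMap (hm : 3 ≤ m) (L : C(𝕊¹, PosMat m)) : cls (stabMap L) = cls L := by
  by_cases hL : L.Nullhomotopic
  · rw [cls_of_nullhomotopic hL, cls_of_nullhomotopic ((nullhomotopic_stabMap_iff hm L).mpr hL)]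
  · rw [(cls_eq_one_iff L).mpr hL, (cls_eq_one_iff _).mpr (fun h => hL ((nullhomotopic_stabMap_iff hm L).mp h))]

/-- A matrix of positive determinant is a unit. [folklore] -/
theorem PosMat.isUnit_val (A : PosMat m) : IsUnit A.1 :=
  (Matrix.isUnit_iff_isUnit_det _).mpr (isUnit_iff_ne_zero.mpr A.2.ne')

/-- The inverse matrix, in `GL⁺`. [folklore] -/
def PosMat.inv (A : PosMat m) : PosMat m :=
  ⟨A.1⁻¹, by
    rw [Matrix.det_nonsing_inv, Ring.inverse_eq_inv']
    exact inv_pos.mpr A.2⟩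

/-- `A⁻¹ A = 1`. [folklore] -/
theorem PosMat.inv_mul (A : PosMat m) : A.inv * A = 1 :=
  Subtype.ext (Matrix.nonsing_inv_mul _ ((Matrix.isUnit_iff_isUnit_det _).mp A.isUnit_val))

/-- `A A⁻¹ = 1`. [folklore] -/
theorem PosMat.mul_inv (A : PosMat m) : A * A.inv = 1 :=
  Subtype.ext (Matrix.mul_nonsing_inv _ ((Matrix.isUnit_iff_isUnit_det _).mp A.isUnit_val))

/-- Products of constant loops. [folklore] -/
theorem const_mul_const (A B : PosMat m) :
    ContinuousMap.const 𝕊¹ A * ContinuousMap.const 𝕊¹ B = ContinuousMap.const 𝕊¹ (A * B) := by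
  ext u : 1; rfl

/-- Multiplying by a constant does not change null-homotopy (left). [folklore] -/
theorem nullhomotopic_const_mul_iff (A : PosMat m) (L : C(𝕊¹, PosMat m)) :
    (ContinuousMap.const 𝕊¹ A * L).Nullhomotopic ↔ L.Nullhomotopic := by
  constructor
  · rintro ⟨B, hB⟩
    refine ⟨A.inv * B, ?_⟩
    have h := Homotopic.const_mul A.inv hB
    have h1 : ContinuousMap.const 𝕊¹ A.inv * (ContinuousMap.const 𝕊¹ A * L) = L := by
      ext u : 1; change A.inv * (A * L u) = L u; rw [← mul_assoc, PosMat.inv_mul, one_mul]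
    rwa [h1, const_mul_const] at h
  · rintro ⟨B, hB⟩
    refine ⟨A * B, ?_⟩
    have h := Homotopic.const_mul A hB
    rwa [const_mul_const] at h

/-- Multiplying by a constant does not change null-homotopy (right). [folklore] -/
theorem nullhomotopic_mul_const_iff (A : PosMat m) (L : C(𝕊¹, PosMat m)) :
    (L * ContinuousMap.const 𝕊¹ A).Nullhomotopic ↔ L.Nullhomotopic := by
  constructor
  · rintro ⟨B, hB⟩
    refine ⟨B * A.inv, ?_⟩
    have h := Homotopic.mul hB (ContinuousMap.Homotopic.refl (ContinuousMap.const 𝕊¹ A.inv))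
    have h1 : L * ContinuousMap.const 𝕊¹ A * ContinuousMap.const 𝕊¹ A.inv = L := by
      ext u : 1; change L u * A * A.inv = L u; rw [mul_assoc, PosMat.mul_inv, mul_one]
    rwa [h1, const_mul_const] at h
  · rintro ⟨B, hB⟩
    refine ⟨B * A, ?_⟩
    have h := Homotopic.mul hB (ContinuousMap.Homotopic.refl (ContinuousMap.const 𝕊¹ A))
    rwa [const_mul_const] at h

/-- **Additivity of the class** (`m ≥ 3`): `cls (L₁ L₂) = cls L₁ + cls L₂` for the pointwise product —
the dichotomy and `τ · τ ≃ 1`. [cite: GompfStipsiczGSM1999, §5.2] -/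
theorem cls_mul' (m : ℕ) (L₁ L₂ : C(𝕊¹, PosMat (m + 3))) : cls (L₁ * L₂) = cls L₁ + cls L₂ := by
  by_cases h₁ : L₁.Nullhomotopic
  · obtain ⟨A, hA⟩ := h₁
    have hh : (L₁ * L₂).Homotopic (ContinuousMap.const 𝕊¹ A * L₂) := Homotopic.mul hA (ContinuousMap.Homotopic.refl _)
    rw [cls_congr hh, cls_of_nullhomotopic ⟨A, hA⟩, zero_add]
    by_cases h₂ : L₂.Nullhomotopic
    · rw [cls_of_nullhomotopic h₂, cls_of_nullhomotopic ((nullhomotopic_const_mul_iff A L₂).mpr h₂)]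
    · rw [(cls_eq_one_iff L₂).mpr h₂, (cls_eq_one_iff _).mpr (fun h => h₂ ((nullhomotopic_const_mul_iff A L₂).mp h))]
  · by_cases h₂ : L₂.Nullhomotopic
    · obtain ⟨B, hB⟩ := h₂
      have hh : (L₁ * L₂).Homotopic (L₁ * ContinuousMap.const 𝕊¹ B) := Homotopic.mul (ContinuousMap.Homotopic.refl _) hB
      rw [cls_congr hh, cls_of_nullhomotopic ⟨B, hB⟩, add_zero, (cls_eq_one_iff L₁).mpr h₁,
        (cls_eq_one_iff _).mpr (fun h => h₁ ((nullhomotopic_mul_const_iff B L₁).mp h))]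
    · have ht₁ : L₁.Homotopic (tau m) := (nullhomotopic_or_homotopic_tau m L₁).resolve_left h₁
      have ht₂ : L₂.Homotopic (tau m) := (nullhomotopic_or_homotopic_tau m L₂).resolve_left h₂
      rw [(cls_eq_one_iff L₁).mpr h₁, (cls_eq_one_iff L₂).mpr h₂, cls_congr (Homotopic.mul ht₁ ht₂),
        cls_of_nullhomotopic (nullhomotopic_tau_mul m)]
      decide

/-- **Additivity of the class** for `m ≥ 3`. [cite: GompfStipsiczGSM1999, §5.2] -/
theorem cls_mul (hm : 3 ≤ m) (L₁ L₂ : C(𝕊¹, PosMat m)) : cls (L₁ * L₂) = cls L₁ + cls L₂ := by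
  obtain ⟨k, rfl⟩ : ∃ k, m = k + 3 := ⟨m - 3, by omega⟩
  exact cls_mul' k L₁ L₂

/-- Left multiplication by a constant does not change the class. [folklore] -/
theorem cls_const_mul (A : PosMat m) (L : C(𝕊¹, PosMat m)) : cls (ContinuousMap.const 𝕊¹ A * L) = cls L := by
  by_cases hL : L.Nullhomotopic
  · rw [cls_of_nullhomotopic hL, cls_of_nullhomotopic ((nullhomotopic_const_mul_iff A L).mpr hL)]
  · rw [(cls_eq_one_iff L).mpr hL, (cls_eq_one_iff _).mpr (fun h => hL ((nullhomotopic_const_mul_iff A L).mp h))]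

/-- Right multiplication by a constant does not change the class. [folklore] -/
theorem cls_mul_const (A : PosMat m) (L : C(𝕊¹, PosMat m)) : cls (L * ContinuousMap.const 𝕊¹ A) = cls L := by
  by_cases hL : L.Nullhomotopic
  · rw [cls_of_nullhomotopic hL, cls_of_nullhomotopic ((nullhomotopic_mul_const_iff A L).mpr hL)]
  · rw [(cls_eq_one_iff L).mpr hL, (cls_eq_one_iff _).mpr (fun h => hL ((nullhomotopic_mul_const_iff A L).mp h))]

end Cls

/-! ### 11. Back to smooth loops: continuously homotopic smooth loops are `Joined` -/

section Bridge

open OpLoop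

/-- The clamp `ℝ → [0, 1]`. [folklore] -/
def clamp (s : ℝ) : ℝ := max 0 (min 1 s)

/-- `clamp s ∈ [0, 1]`. [folklore] -/
theorem clamp_mem (s : ℝ) : clamp s ∈ Icc (0 : ℝ) 1 :=
  ⟨le_max_left _ _, max_le zero_le_one (min_le_left _ _)⟩

/-- `clamp` is continuous. [folklore] -/
theorem continuous_clamp : Continuous clamp := continuous_const.max (continuous_const.min continuous_id)

/-- `clamp 0 = 0`. [folklore] -/
@[simp] theorem clamp_zero : clamp 0 = 0 := by simp [clamp]

/-- `clamp 1 = 1`. [folklore] -/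
@[simp] theorem clamp_one : clamp 1 = 1 := by simp [clamp]

/-- A segment family between two smooth loops inside a room of units is a `Joined` family. [folklore] -/
theorem joined_segment {f g : 𝕊¹ → (𝔼 3 →L[ℝ] 𝔼 3)}
    (hf : ContMDiff (𝓡 1) 𝓘(ℝ, 𝔼 3 →L[ℝ] 𝔼 3) ∞ f) (hg : ContMDiff (𝓡 1) 𝓘(ℝ, 𝔼 3 →L[ℝ] 𝔼 3) ∞ g)
    (hu : ∀ t ∈ Icc (0 : ℝ) 1, ∀ u, IsUnit ((1 - t) • f u + t • g u))
    (hf1 : ∀ u, IsUnit (f u)) (hg1 : ∀ u, IsUnit (g u)) :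
    Joined (ofUnits f hf hf1) (ofUnits g hg hg1) := by
  refine joined_of_family (F := fun t u => (1 - clamp t) • f u + clamp t • g u) (fun t => ?_) (fun t u => hu _ (clamp_mem t) u)
    ?_ ?_ ?_
  · have hc1 : ContMDiff (𝓡 1) 𝓘(ℝ, ℝ) ∞ (fun _ : 𝕊¹ => 1 - clamp t) := contMDiff_const
    have hc2 : ContMDiff (𝓡 1) 𝓘(ℝ, ℝ) ∞ (fun _ : 𝕊¹ => clamp t) := contMDiff_const
    exact (hc1.smul hf).add (hc2.smul hg)
  rotate_left
  · funext u
    change (1 - clamp 0) • f u + clamp 0 • g u = f u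
    rw [clamp_zero, sub_zero, one_smul, show (0 : ℝ) • g u = 0 from zero_smul ℝ (g u), add_zero]
  · funext u
    change (1 - clamp 1) • f u + clamp 1 • g u = g u
    rw [clamp_one, sub_self, show (0 : ℝ) • f u = 0 from zero_smul ℝ (f u), one_smul, zero_add]
  · have hc : Continuous fun p : ℝ × 𝕊¹ => (1 - clamp p.1) • f p.2 + clamp p.1 • g p.2 :=
      ((continuous_const.sub (continuous_clamp.comp continuous_fst)).smul (hf.continuous.comp continuous_snd)).add
        ((continuous_clamp.comp continuous_fst).smul (hg.continuous.comp continuous_snd))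
    exact hc.continuousOn

/-- **Continuously homotopic smooth loops of positive determinant are `Joined`** (smooth
approximation of the homotopy on `ℝ × 𝕊¹` within a uniform room of invertible operators, and
segments at the two ends). With the dichotomy this is the converse of
`homotopic_matLoop_of_joined`. [cite: GompfStipsiczGSM1999, §5.2] -/
theorem joined_of_homotopic_matLoop {L L' : OpLoop} (hL : ∀ u, 0 < LinearMap.det (L.toFun u : 𝔼 3 →ₗ[ℝ] 𝔼 3))
    (hL' : ∀ u, 0 < LinearMap.det (L'.toFun u : 𝔼 3 →ₗ[ℝ] 𝔼 3))
    (h : (matLoop L hL).Homotopic (matLoop L' hL')) : Joined L L' := by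
  obtain ⟨H⟩ := h
  -- the operator-valued homotopy, extended to `ℝ × 𝕊¹`
  let hh : ℝ × 𝕊¹ → (𝔼 3 →L[ℝ] 𝔼 3) := fun p => matCLM (H (Set.projIcc 0 1 zero_le_one p.1, p.2)).1
  have hhc : Continuous hh :=
    continuous_matCLM_pi.comp (continuous_val.comp (H.continuous.comp
      ((continuous_projIcc.comp continuous_fst).prodMk continuous_snd)))
  have hp0 : Set.projIcc (0 : ℝ) 1 zero_le_one 0 = 0 := Subtype.ext (by simp [Set.projIcc])
  have hp1 : Set.projIcc (0 : ℝ) 1 zero_le_one 1 = 1 := Subtype.ext (by simp [Set.projIcc])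
  have hh0 : ∀ u, hh (0, u) = L.toFun u := fun u => by
    simp only [hh]
    rw [hp0, H.apply_zero]; exact matCLM_toMat _
  have hh1 : ∀ u, hh (1, u) = L'.toFun u := fun u => by
    simp only [hh]
    rw [hp1, H.apply_one]; exact matCLM_toMat _
  -- a uniform room around the compact image
  let K : Set (𝔼 3 →L[ℝ] 𝔼 3) := (fun q : I × 𝕊¹ => matCLM (H q).1) '' univ
  have hK : IsCompact K := isCompact_univ.image (continuous_matCLM_pi.comp (continuous_val.comp H.continuous))
  have hKpos : ∀ f ∈ K, 0 < LinearMap.det (f : 𝔼 3 →ₗ[ℝ] 𝔼 3) := by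
    rintro _ ⟨q, -, rfl⟩
    rw [det_matCLM]; exact (H q).2
  have hmem : ∀ p, hh p ∈ K := fun p => ⟨(Set.projIcc 0 1 zero_le_one p.1, p.2), mem_univ _, rfl⟩
  obtain ⟨ε, hε, hroom⟩ := exists_eps_det_pos hK hKpos
  -- smooth approximation on the manifold `ℝ × 𝕊¹`
  obtain ⟨G, hG, -⟩ := hhc.exists_contMDiff_approx (𝓘(ℝ, ℝ).prod (𝓡 1)) (⊤ : ℕ∞) continuous_const
    (fun _ : ℝ × 𝕊¹ => hε)
  have hGs : ContMDiff (𝓘(ℝ, ℝ).prod (𝓡 1)) 𝓘(ℝ, 𝔼 3 →L[ℝ] 𝔼 3) ∞ G := G.contMDiff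
  have hGt : ∀ t : ℝ, ContMDiff (𝓡 1) 𝓘(ℝ, 𝔼 3 →L[ℝ] 𝔼 3) ∞ fun u => G (t, u) := fun t =>
    hGs.comp (contMDiff_const.prodMk contMDiff_id)
  -- segments within the room are invertible
  have hsegU : ∀ (p : ℝ × 𝕊¹) (t : ℝ), t ∈ Icc (0 : ℝ) 1 → IsUnit ((1 - t) • hh p + t • G p) := by
    intro p t ht
    refine isUnit_of_det_ne_zero (hroom (hh p) (hmem p) _ ?_).ne'
    have h1 : (1 - t) • hh p = hh p - t • hh p := by rw [sub_smul (1 : ℝ) t (hh p), one_smul]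
    have : (1 - t) • hh p + t • G p - hh p = t • (G p - hh p) := by rw [h1, smul_sub]; abel
    rw [dist_eq_norm, this, norm_smul, Real.norm_eq_abs, abs_of_nonneg ht.1]
    calc t * ‖G p - hh p‖ ≤ 1 * ‖G p - hh p‖ := by gcongr; exact ht.2
      _ = dist (G p) (hh p) := by rw [_root_.one_mul, dist_eq_norm]
      _ < ε := hG p
  have hGU : ∀ p, IsUnit (G p) := fun p => by
    have := hsegU p 1 ⟨zero_le_one, le_rfl⟩
    rwa [sub_self, show (0 : ℝ) • hh p = 0 from zero_smul ℝ (hh p), zero_add, one_smul] at this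
  -- the three pieces
  have hJ₁ : Joined L (ofUnits (fun u => G (0, u)) (hGt 0) fun u => hGU _) := by
    have h := joined_segment L.contMDiff_toFun (hGt 0) (fun t ht u => ?_) L.isUnit_toFun (fun u => hGU _)
    · rwa [← eq_ofUnits L] at h
    · have := hsegU (0, u) t ht; rwa [hh0] at this
  have hJ₂ : Joined (ofUnits (fun u => G (0, u)) (hGt 0) fun u => hGU _)
      (ofUnits (fun u => G (1, u)) (hGt 1) fun u => hGU _) := by
    refine joined_of_family (F := fun t u => G (clamp t, u)) (fun t => hGt _) (fun t u => hGU _) ?_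
      (by funext u; simp only [clamp_zero]; rfl) (by funext u; simp only [clamp_one]; rfl)
    exact (hGs.continuous.comp ((continuous_clamp.comp continuous_fst).prodMk continuous_snd)).continuousOn
  have hJ₃ : Joined (ofUnits (fun u => G (1, u)) (hGt 1) fun u => hGU _) L' := by
    have h := joined_segment (hGt 1) L'.contMDiff_toFun (fun t ht u => ?_) (fun u => hGU _) L'.isUnit_toFun
    · rwa [← eq_ofUnits L'] at h
    · -- the reversed segment from `G (1, u)` to `L' u = hh (1, u)`
      have := hsegU (1, u) (1 - t) ⟨by linarith [ht.2], by linarith [ht.1]⟩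
      rw [hh1, sub_sub_cancel] at this
      rwa [add_comm]
  exact (hJ₁.trans hJ₂).trans hJ₃

/-- **`GL⁺(3, ℝ)` is path connected, in the form needed**: every constant loop is homotopic to the
constant loop `1` (the tree's smooth path `nonempty_smoothMatrixPath_of_det_pos`).
[cite: HirschDT1976, Ch. 4 §6, proof of Thm. 6.6] -/
theorem homotopic_const_one (A : PosMat 3) :
    (ContinuousMap.const 𝕊¹ A).Homotopic (ContinuousMap.const 𝕊¹ (1 : PosMat 3)) := by
  obtain ⟨γ⟩ := nonempty_smoothMatrixPath_of_det_pos A.1 A.2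
  have hγc : Continuous γ.toFun := continuous_matrix fun i j => (γ.contDiff_apply i j).continuous
  have hne : ∀ θ, (γ.toFun θ).det ≠ 0 := fun θ h0 => by
    have := congrArg Matrix.det (γ.mul_inv θ)
    rw [Matrix.det_mul, h0, zero_mul, Matrix.det_one] at this
    exact zero_ne_one this
  have hpos : ∀ θ, 0 < (γ.toFun θ).det := fun θ => by
    rcases lt_or_gt_of_ne (hne θ) with hlt | hgt
    · exfalso
      have h0 : 0 < (γ.toFun 0).det := by rw [γ.eq_one 0 le_rfl, Matrix.det_one]; exact one_pos
      obtain ⟨s, -, hs⟩ := isPreconnected_univ.intermediate_value₂ (mem_univ θ) (mem_univ 0)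
        (hγc.matrix_det.continuousOn) continuousOn_const hlt.le h0.le
      exact hne s hs
    · exact hgt
  refine ⟨ContinuousMap.Homotopy.symm
    { toFun := fun p => ⟨γ.toFun p.1, hpos p.1⟩,
      continuous_toFun := (hγc.comp (continuous_subtype_val.comp continuous_fst)).subtype_mk _,
      map_zero_left := fun u => Subtype.ext (by change γ.toFun 0 = 1; exact γ.eq_one 0 le_rfl),
      map_one_left := fun u => Subtype.ext (by change γ.toFun 1 = A.1; exact γ.eq_self 1 le_rfl) }⟩

/-- For loops in `GL⁺(3, ℝ)`, class `0` means homotopic to the constant loop `1`. [folklore] -/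
theorem cls_eq_zero_iff_homotopic_one (L : C(𝕊¹, PosMat 3)) :
    cls L = 0 ↔ L.Homotopic (ContinuousMap.const 𝕊¹ (1 : PosMat 3)) := by
  rw [cls_eq_zero_iff]
  exact ⟨fun ⟨A, hA⟩ => hA.trans (homotopic_const_one A), fun h => ⟨1, h⟩⟩

/-- **A smooth loop of positive determinant whose matrix loop has class `0` is `Joined` to the
constant loop `1`.** [cite: GompfStipsiczGSM1999, §5.2] -/
theorem joined_one_of_cls_eq_zero {L : OpLoop} (hL : ∀ u, 0 < LinearMap.det (L.toFun u : 𝔼 3 →ₗ[ℝ] 𝔼 3))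
    (h : cls (matLoop L hL) = 0) : Joined L one := by
  rw [cls_eq_zero_iff_homotopic_one, ← matLoop_one] at h
  exact joined_of_homotopic_matLoop hL det_pos_one h

/-- **The class of a smooth loop decides the surgery**: `cls = 0` iff `Joined` to `1`.
[cite: GompfStipsiczGSM1999, §5.2] -/
theorem cls_matLoop_eq_zero_iff {L : OpLoop} (hL : ∀ u, 0 < LinearMap.det (L.toFun u : 𝔼 3 →ₗ[ℝ] 𝔼 3)) :
    cls (matLoop L hL) = 0 ↔ Joined L one :=
  ⟨joined_one_of_cls_eq_zero hL, fun h => by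
    rw [cls_eq_zero_iff_homotopic_one, ← matLoop_one]
    exact homotopic_matLoop_of_joined h hL det_pos_one⟩

/-- The class of the twisted loop's matrix loop is `cls (tau 0)`; a smooth loop has class `0` or
is `Joined` to the twist. [cite: GompfStipsiczGSM1999, §5.2] -/
theorem joined_one_or_twist_of_cls {L : OpLoop} (hL : ∀ u, 0 < LinearMap.det (L.toFun u : 𝔼 3 →ₗ[ℝ] 𝔼 3)) :
    (cls (matLoop L hL) = 0 ∧ Joined L one) ∨ (cls (matLoop L hL) = cls (tau 0) ∧ Joined L twist) := by
  rcases exists_joined_one_or_twist L (hL ptA) with hJ | hJ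
  · exact Or.inl ⟨(cls_matLoop_eq_zero_iff hL).mpr hJ, hJ⟩
  · exact Or.inr ⟨cls_congr (homotopic_matLoop_of_joined hJ hL det_pos_twist), hJ⟩

end Bridge

end GLLoop

end Literature.Topology.FourManifolds
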